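import Literature.NumberTheory.Automorphic.CDTTheorem722SerreLevelProofs
import Literature.NumberTheory.EllipticCurves.IsogenyFrobeniusTraceHoldsProofs
import HarnessLib

/-!
# CDT Theorem 7.2.2, proofs file V: Faltings' isogeny theorem discharged — both roads to
# Theorem 7.2.2 re-threaded on the two remaining classical facts (Eichler–Shimura, Carayol)

Sibling *proofs* file (theorems only: no definition, no named fact, no instance, no `sorry`) of
`CDTTheorem722`, `…Proofs`, `…ThreeFactsProofs`, `…SerreProofs`, `…SerreLevelProofs`, for the named
fact `Literature.NumberTheory.Automorphic.BCDT.CDT_theorem_7_2_2` (Conrad–Diamond–Taylor, J. Amer.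
Math. Soc. 12 (1999), Thm. 7.2.2: *"Let `E/ℚ` be an elliptic curve such that `ρ̄_{E,5}|ℚ(√5)` is
absolutely irreducible. If `ρ̄_{E,5}` is modular, then `E` is modular."*).

The earlier files reduced `CDT_theorem_7_2_2` along two roads, each granted three catalogued
classical facts — `eichlerShimuraConstruction` (Eichler–Shimura), `WeierstrassCurve.isIsogenous_iff_
frobeniusTrace_eq` (Faltings 1983, §5 Kor. 2) and `IsNewformOf.level_eq_conductorNorm` (Carayol):

* **the printed road** (`CDTTheorem722ThreeFactsProofs`): `CDT_theorem_7_2_2 ⇔ hlift`, the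
  `5`-adic modularity lifting statement of its proof (CDT pp. 553–554: Thm. 7.1.1 with Diamond 1996
  Thm. 5.3), the glue being BCDT's "(3) ⇒ (2)";
* **Serre's road** (`CDTTheorem722SerreProofs`, `CDTTheorem722SerreLevelProofs`): Serre, Duke Math.
  J. 54 (1987), §4.6, Théorème 4, from `khare_wintenberger`, the weight of `ρ̄_{E,p}` (`hwt`) and the
  catalogued `ℓ`-adic description of `N_E` (`WeierstrassCurve.conductorNatOf_geomPoints_eq_
  conductorNorm_of_isElliptic`).

The tree has since *proved* Faltings' fact — `WeierstrassCurve.isIsogenous_iff_frobeniusTrace_eq_holds`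
(`IsogenyFrobeniusTraceHoldsProofs`, along Bost's route: algebraic leaves and André's criterion) —
and this file feeds that theorem into both roads.  Every statement below is the corresponding
`…_of_three_facts` theorem with `hF` discharged; the two remaining classical inputs are
Eichler–Shimura (`hES`) and Carayol (`hC`).

* `isModular_of_isModularGaloisRepTate_of_two_facts`, `three_imp_two_of_two_facts`,
  `isModular_iff_isModularGaloisRepTate_of_two_facts` — BCDT's "(3) ⇒ (2)" / "(2) ⇔ (3) ⇔ (4)";
* `CDT_theorem_7_2_2_of_lift_of_two_facts`, `CDT_theorem_7_2_2_iff_lift_of_two_facts` — the printed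
  road: `CDT_theorem_7_2_2 ⇔ hlift` granted Eichler–Shimura and Carayol only;
* `isModular_of_theoremB_of_CDT721_lift_723_of_two_facts`,
  `CDT_theorem_7_1_2_of_theoremB_of_7_2_1_of_lift_of_7_2_3_of_two_facts`,
  `CDT_theorem_7_2_4_of_theoremB_of_7_2_1_of_lift_of_7_2_3_of_ogg3two_of_two_facts`,
  `exists_isNewformOf_of_theoremB_of_CDT721_lift_723_of_ogg3two_of_two_facts`,
  `exists_isNewformOf_of_serre_of_CDT721_lift_723_of_ogg3two_of_two_facts`,
  `exists_isNewformOf_of_wild_of_auxiliaryCurve_of_CDT721_lift_723_of_swan_of_two_facts` — BCDT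
  Theorem A re-threaded;
* `isModular_of_isNewform0_of_cuspCoeff_eq_off_of_two_facts`,
  `isModular_of_forall_isTorsionGaloisRep_exists_isNewform1_of_two_facts` (Serre's Théorème 4),
  `isModular_of_khare_wintenberger_of_serreWeight_of_conductorNatOf_of_two_facts`,
  `exists_isNewformOf_of_khare_wintenberger_of_serreWeight_of_conductorNatOf_of_two_facts`,
  `CDT_theorem_7_2_2_of_khare_wintenberger_of_serreWeight_of_conductorNatOf_of_two_facts` — Serre's
  road: `CDT_theorem_7_2_2` from {`khare_wintenberger`, `hwt`, the conductor fact, Eichler–Shimura,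
  Carayol}.

## References

* B. Conrad, F. Diamond, R. Taylor, *Modularity of certain potentially Barsotti–Tate Galois
  representations*, J. Amer. Math. Soc. 12 (1999), Thm. 7.1.2, 7.2.2, 7.2.4. [ConradDiamondTaylor1999]
* C. Breuil, B. Conrad, F. Diamond, R. Taylor, J. Amer. Math. Soc. 14 (2001), Introduction
  ((3) ⇒ (2), proof of Theorem A). [BCDTJAMS2001]
* J.-P. Serre, Duke Math. J. 54 (1987), §4.6, Théorème 4, Lemme 5. [Serre1987]
* G. Faltings, Invent. Math. 73 (1983), §5 Korollar 2. [Faltings1983Endlichkeit]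
-/

noncomputable section

open scoped MatrixGroups ModularForm Valued

open CongruenceSubgroup

namespace Literature.NumberTheory.Automorphic.BCDT

open WeierstrassCurve GaloisRepresentations EllipticCurves EllipticCurves.ModularForms

/-! ## BCDT "(3) ⇒ (2)" granted Eichler–Shimura and Carayol -/

/-- **(3) ⇒ (2) of BCDT's Introduction, granted Eichler–Shimura and Carayol only** (Faltings'
isogeny theorem being the tree's theorem `WeierstrassCurve.isIsogenous_iff_frobeniusTrace_eq_holds`):
for an elliptic `W / ℚ` and a prime `ℓ`, if `ρ_{E,ℓ}` is modular (`IsModularGaloisRepTate`) then `E`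
is modular (`isModular_of_isModularGaloisRepTate_of_three_facts` with `hF` discharged).
[cite: BCDTJAMS2001, Introduction ((3) ⇒ (2))] -/
theorem isModular_of_isModularGaloisRepTate_of_two_facts
    (hES : eichlerShimuraConstruction)
    (hC : ∀ (N : ℕ) [NeZero N], IsNewformOf.level_eq_conductorNorm (N := N))
    (W : WeierstrassCurve ℚ) [W.IsElliptic] [NeZero (W.conductorNorm ℤ)] (ℓ : ℕ) [Fact ℓ.Prime]
    (h : W.IsModularGaloisRepTate ℓ) : IsModular W :=
  isModular_of_isModularGaloisRepTate_of_three_facts hES isIsogenous_iff_frobeniusTrace_eq_holds hC W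
    ℓ h

/-- **(3) ⇒ (2) at `ℓ = 5`** (the hypothesis `h32` of `CDTTheorem722`), granted Eichler–Shimura and
Carayol. [cite: BCDTJAMS2001, Introduction ((3) ⇒ (2))] -/
theorem three_imp_two_of_two_facts
    (hES : eichlerShimuraConstruction)
    (hC : ∀ (N : ℕ) [NeZero N], IsNewformOf.level_eq_conductorNorm (N := N)) :
    ∀ (W : WeierstrassCurve ℚ) [W.IsElliptic] [NeZero (W.conductorNorm ℤ)],
      W.IsModularGaloisRepTate 5 → IsModular W :=
  three_imp_two_of_three_facts hES isIsogenous_iff_frobeniusTrace_eq_holds hC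

/-- **Conditions (2), (3), (4) of BCDT's Introduction agree, granted Eichler–Shimura and Carayol**:
`E` is modular iff `ρ_{E,ℓ}` is. [cite: BCDTJAMS2001, Introduction (conditions (2)–(4))] -/
theorem isModular_iff_isModularGaloisRepTate_of_two_facts
    (hES : eichlerShimuraConstruction)
    (hC : ∀ (N : ℕ) [NeZero N], IsNewformOf.level_eq_conductorNorm (N := N))
    (W : WeierstrassCurve ℚ) [W.IsElliptic] [NeZero (W.conductorNorm ℤ)] (ℓ : ℕ) [Fact ℓ.Prime] :
    IsModular W ↔ W.IsModularGaloisRepTate ℓ :=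
  isModular_iff_isModularGaloisRepTate_of_three_facts hES isIsogenous_iff_frobeniusTrace_eq_holds hC W ℓ

/-! ## The printed road: CDT Theorem 7.2.2 versus its `5`-adic lifting statement -/

/-- **Conrad–Diamond–Taylor 1999, Theorem 7.2.2 from its `5`-adic lifting statement, granted
Eichler–Shimura and Carayol** (`CDT_theorem_7_2_2_of_lift_of_three_facts` with Faltings discharged).
[cite: ConradDiamondTaylor1999, Thm. 7.2.2 (proof, pp. 553–554)] -/
theorem CDT_theorem_7_2_2_of_lift_of_two_facts
    (hES : eichlerShimuraConstruction)
    (hC : ∀ (N : ℕ) [NeZero N], IsNewformOf.level_eq_conductorNorm (N := N))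
    (hlift : ∀ (W : WeierstrassCurve ℚ) [W.IsElliptic] (ρ : ModPGaloisRep ℚ (ZMod 5) 2),
      W.IsTorsionGaloisRep 5 ρ → ρ.IsAbsIrreducibleOverSqrt 5 → ρ.IsModular →
      W.IsModularGaloisRepTate 5) :
    CDT_theorem_7_2_2 :=
  CDT_theorem_7_2_2_of_lift_of_three_facts hES isIsogenous_iff_frobeniusTrace_eq_holds hC hlift

/-- **Inside the tree, CDT Theorem 7.2.2 is equivalent to its `5`-adic (Galois-theoretic) form,
granted only Eichler–Shimura and Carayol**: what the named fact `CDT_theorem_7_2_2` asserts beyond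
those two catalogued classical facts is exactly the `5`-adic modularity lifting statement of
pp. 553–554 of CDT (Thm. 7.1.1 with Diamond 1996 Thm. 5.3).
[cite: ConradDiamondTaylor1999, Thm. 7.2.2 (proof, pp. 553–554)] -/
theorem CDT_theorem_7_2_2_iff_lift_of_two_facts
    (hES : eichlerShimuraConstruction)
    (hC : ∀ (N : ℕ) [NeZero N], IsNewformOf.level_eq_conductorNorm (N := N)) :
    CDT_theorem_7_2_2 ↔
      ∀ (W : WeierstrassCurve ℚ) [W.IsElliptic] (ρ : ModPGaloisRep ℚ (ZMod 5) 2),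
        W.IsTorsionGaloisRep 5 ρ → ρ.IsAbsIrreducibleOverSqrt 5 → ρ.IsModular →
        W.IsModularGaloisRepTate 5 :=
  CDT_theorem_7_2_2_iff_lift_of_three_facts hES isIsogenous_iff_frobeniusTrace_eq_holds hC

/-! ## BCDT Theorem A re-threaded, granted Eichler–Shimura and Carayol -/

/-- **BCDT, proof of Theorem A for a given `E / ℚ` by the three cases of the Introduction**, with
"(3) ⇒ (2)" from Eichler–Shimura and Carayol (Faltings discharged).
[cite: BCDTJAMS2001, Introduction (proof of Theorem A, cases 1–3; (3) ⇒ (2))] -/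
theorem isModular_of_theoremB_of_CDT721_lift_723_of_two_facts (hB : theoremB)
    (h721 : CDT_theorem_7_2_1)
    (hlift : ∀ (W : WeierstrassCurve ℚ) [W.IsElliptic] (ρ : ModPGaloisRep ℚ (ZMod 5) 2),
      W.IsTorsionGaloisRep 5 ρ → ρ.IsAbsIrreducibleOverSqrt 5 → ρ.IsModular →
      W.IsModularGaloisRepTate 5)
    (hES : eichlerShimuraConstruction)
    (hC : ∀ (N : ℕ) [NeZero N], IsNewformOf.level_eq_conductorNorm (N := N))
    (h723 : CDT_lemma_7_2_3_isModular)
    (W : WeierstrassCurve ℚ) [W.IsElliptic] [NeZero (W.conductorNorm ℤ)]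
    (h27 : ∀ ρ : ModPGaloisRep ℚ (ZMod 5) 2, W.IsTorsionGaloisRep 5 ρ →
      ¬ ρ.IsAbsIrreducibleOverSqrt 5 → ¬ 27 ∣ W.conductorNorm ℤ) :
    IsModular W :=
  isModular_of_theoremB_of_CDT721_lift_723_of_three_facts hB h721 hlift hES
    isIsogenous_iff_frobeniusTrace_eq_holds hC h723 W h27

/-- **CDT Theorem 7.1.2** (`27 ∤ N_E ⇒ E` modular) **from Theorem B, CDT Thm. 7.2.1, the `5`-adic
lifting step of Thm. 7.2.2, Eichler–Shimura, Carayol and Lemma 7.2.3** (Faltings discharged).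
[cite: ConradDiamondTaylor1999, Thm. 7.1.2 and Thm. 7.2.2 (proof, pp. 553–556)] -/
theorem CDT_theorem_7_1_2_of_theoremB_of_7_2_1_of_lift_of_7_2_3_of_two_facts (hB : theoremB)
    (h721 : CDT_theorem_7_2_1)
    (hlift : ∀ (W : WeierstrassCurve ℚ) [W.IsElliptic] (ρ : ModPGaloisRep ℚ (ZMod 5) 2),
      W.IsTorsionGaloisRep 5 ρ → ρ.IsAbsIrreducibleOverSqrt 5 → ρ.IsModular →
      W.IsModularGaloisRepTate 5)
    (hES : eichlerShimuraConstruction)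
    (hC : ∀ (N : ℕ) [NeZero N], IsNewformOf.level_eq_conductorNorm (N := N))
    (h723 : CDT_lemma_7_2_3_isModular) :
    CDT_theorem_7_1_2 :=
  CDT_theorem_7_1_2_of_theoremB_of_7_2_1_of_lift_of_7_2_3_of_three_facts hB h721 hlift hES
    isIsogenous_iff_frobeniusTrace_eq_holds hC h723

/-- **CDT Theorem 7.2.4 from Theorem B, CDT Thm. 7.2.1, the `5`-adic lifting step of Thm. 7.2.2,
Eichler–Shimura, Carayol, Lemma 7.2.3 and Ogg's formula for `V₂` at `p = 3`** (Faltings discharged).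
[cite: ConradDiamondTaylor1999, Thm. 7.2.4 (p. 556) and Thm. 7.2.2 (proof, pp. 553–554)] -/
theorem CDT_theorem_7_2_4_of_theoremB_of_7_2_1_of_lift_of_7_2_3_of_ogg3two_of_two_facts
    (hB : theoremB) (h721 : CDT_theorem_7_2_1)
    (hlift : ∀ (W : WeierstrassCurve ℚ) [W.IsElliptic] (ρ : ModPGaloisRep ℚ (ZMod 5) 2),
      W.IsTorsionGaloisRep 5 ρ → ρ.IsAbsIrreducibleOverSqrt 5 → ρ.IsModular →
      W.IsModularGaloisRepTate 5)
    (hES : eichlerShimuraConstruction)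
    (hC : ∀ (N : ℕ) [NeZero N], IsNewformOf.level_eq_conductorNorm (N := N))
    (h723 : CDT_lemma_7_2_3_isModular)
    (hOgg3two : ∀ W : WeierstrassCurve ℚ,
      W.swanConductorAt_rationalTate_eq_wildConductorExponent_of_ringChar_eq_three 2) :
    CDT_theorem_7_2_4 :=
  CDT_theorem_7_2_4_of_theoremB_of_7_2_1_of_lift_of_7_2_3_of_ogg3two_of_three_facts hB h721 hlift
    hES isIsogenous_iff_frobeniusTrace_eq_holds hC h723 hOgg3two

/-- **BCDT Theorem A** (`exists_isNewformOf`) **from Theorem B, CDT Thm. 7.2.1, the `5`-adic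
lifting step of CDT Thm. 7.2.2, Eichler–Shimura, Carayol, CDT Lemma 7.2.3 and Ogg's formula for
`V₂` at the additive places of residue characteristic `3`** (Faltings discharged).
[cite: BCDTJAMS2001, Theorem A; Introduction (proof of Theorem A, cases 1–3; (3) ⇒ (2))] -/
theorem exists_isNewformOf_of_theoremB_of_CDT721_lift_723_of_ogg3two_of_two_facts (hB : theoremB)
    (h721 : CDT_theorem_7_2_1)
    (hlift : ∀ (W : WeierstrassCurve ℚ) [W.IsElliptic] (ρ : ModPGaloisRep ℚ (ZMod 5) 2),
      W.IsTorsionGaloisRep 5 ρ → ρ.IsAbsIrreducibleOverSqrt 5 → ρ.IsModular →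
      W.IsModularGaloisRepTate 5)
    (hES : eichlerShimuraConstruction)
    (hC : ∀ (N : ℕ) [NeZero N], IsNewformOf.level_eq_conductorNorm (N := N))
    (h723 : CDT_lemma_7_2_3_isModular)
    (hOgg3two : ∀ W : WeierstrassCurve ℚ,
      W.swanConductorAt_rationalTate_eq_wildConductorExponent_of_ringChar_eq_three 2) :
    EllipticCurves.ModularForms.exists_isNewformOf :=
  exists_isNewformOf_of_theoremB_of_CDT721_lift_723_of_ogg3two_of_three_facts hB h721 hlift hES
    isIsogenous_iff_frobeniusTrace_eq_holds hC h723 hOgg3two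

/-- **Theorem A from Serre's conjecture (3.2.3) at `p = 5` in place of Theorem B**, with the same
finer inputs and Faltings discharged. [cite: BCDTJAMS2001, Introduction; Theorem A] -/
theorem exists_isNewformOf_of_serre_of_CDT721_lift_723_of_ogg3two_of_two_facts
    (hSerre : ∀ (k : Type) [Field k] [TopologicalSpace k] [DiscreteTopology k],
      exists_newform_of_odd_irreducible (p := 5) (k := k))
    (h721 : CDT_theorem_7_2_1)
    (hlift : ∀ (W : WeierstrassCurve ℚ) [W.IsElliptic] (ρ : ModPGaloisRep ℚ (ZMod 5) 2),
      W.IsTorsionGaloisRep 5 ρ → ρ.IsAbsIrreducibleOverSqrt 5 → ρ.IsModular →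
      W.IsModularGaloisRepTate 5)
    (hES : eichlerShimuraConstruction)
    (hC : ∀ (N : ℕ) [NeZero N], IsNewformOf.level_eq_conductorNorm (N := N))
    (h723 : CDT_lemma_7_2_3_isModular)
    (hOgg3two : ∀ W : WeierstrassCurve ℚ,
      W.swanConductorAt_rationalTate_eq_wildConductorExponent_of_ringChar_eq_three 2) :
    EllipticCurves.ModularForms.exists_isNewformOf :=
  exists_isNewformOf_of_serre_of_CDT721_lift_723_of_ogg3two_of_three_facts hSerre h721 hlift hES
    isIsogenous_iff_frobeniusTrace_eq_holds hC h723 hOgg3two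

/-- **The Modularity Theorem (BCDT Theorem A) from the deep printed inputs, with Theorem B
decomposed and CDT Theorem 7.2.2 unfolded into its `5`-adic lifting step**, "(3) ⇒ (2)" from
Eichler–Shimura and Carayol (Faltings discharged). [cite: BCDTJAMS2001, Theorem A] -/
theorem exists_isNewformOf_of_wild_of_auxiliaryCurve_of_CDT721_lift_723_of_swan_of_two_facts
    (hW : exists_isTorsionGaloisRep_and_isModular_of_not_isTamelyRamifiedAbove)
    (hE : exists_isTorsionGaloisRep_five_and_surjective_three) (h721 : CDT_theorem_7_2_1)
    (hlift : ∀ (W : WeierstrassCurve ℚ) [W.IsElliptic] (ρ : ModPGaloisRep ℚ (ZMod 5) 2),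
      W.IsTorsionGaloisRep 5 ρ → ρ.IsAbsIrreducibleOverSqrt 5 → ρ.IsModular →
      W.IsModularGaloisRepTate 5)
    (hES : eichlerShimuraConstruction)
    (hC : ∀ (N : ℕ) [NeZero N], IsNewformOf.level_eq_conductorNorm (N := N))
    (h723 : CDT_lemma_7_2_3_isModular)
    (hSw : ∀ W : WeierstrassCurve ℚ, W.swanConductorAt_rationalTate_eq_wildConductorExponent 5) :
    exists_isNewformOf :=
  exists_isNewformOf_of_wild_of_auxiliaryCurve_of_CDT721_lift_723_of_swan_of_three_facts hW hE h721
    hlift hES isIsogenous_iff_frobeniusTrace_eq_holds hC h723 hSw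

/-! ## Serre's road, granted Eichler–Shimura and Carayol -/

section SerreRoad

open ValuativeRel GaloisRepresentations.ModPGaloisRep GaloisRepresentations.IsNonarchimedeanLocalField

/-- **Last paragraph of Serre's proof of Théorème 4, granted Eichler–Shimura and Carayol**: a
newform `g ∈ S₂(Γ₀(N))` with `a_q(g) = a_q(E)` off `N R` makes `E` modular
(`isModular_of_isNewform0_of_cuspCoeff_eq_off_of_three_facts` with Faltings discharged).
[cite: Serre1987, §4.6, proof of Théorème 4 and Remarque (2)] -/
theorem isModular_of_isNewform0_of_cuspCoeff_eq_off_of_two_facts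
    (hES : eichlerShimuraConstruction)
    (hC : ∀ (N : ℕ) [NeZero N], IsNewformOf.level_eq_conductorNorm (N := N))
    (W : WeierstrassCurve ℚ) [W.IsElliptic] [NeZero (W.conductorNorm ℤ)] {N : ℕ} [NeZero N]
    {g : CuspForm (Gamma0 N) 2} (hg : IsNewform0 g) {R : ℕ} [NeZero R]
    (h : ∀ q : ℕ, q.Prime → ¬ q ∣ N * R → cuspCoeff g q = (W.LFunction q : ℂ)) : IsModular W :=
  isModular_of_isNewform0_of_cuspCoeff_eq_off_of_three_facts hES isIsogenous_iff_frobeniusTrace_eq_holds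
    hC W hg h

/-- **Serre's Théorème 4 in the tree, granted Eichler–Shimura and Carayol**: if for all primes
`p ≥ p₀` every framed model of `E[p]`, after extension of scalars, is attached to a newform of
weight `2` and level `≤ M`, then `E` is modular
(`isModular_of_forall_isTorsionGaloisRep_exists_isNewform1_of_three_facts` with Faltings discharged).
[cite: Serre1987, §4.6, Théorème 4 and its proof (with Lemme 5, (4.6.4), Remarque (2))] -/
theorem isModular_of_forall_isTorsionGaloisRep_exists_isNewform1_of_two_facts
    (hES : eichlerShimuraConstruction)
    (hC : ∀ (N : ℕ) [NeZero N], IsNewformOf.level_eq_conductorNorm (N := N))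
    (W : WeierstrassCurve ℚ) [W.IsElliptic] [NeZero (W.conductorNorm ℤ)] (M p₀ : ℕ)
    (h : ∀ (p : ℕ) [Fact p.Prime], p₀ ≤ p →
      ∀ ρ : ModPGaloisRep ℚ (ZMod p) 2, W.IsTorsionGaloisRep p ρ →
        ∃ (N : ℕ) (_ : NeZero N) (_ : N ≤ M) (f : CuspForm (Gamma1 N) 2)
          (K : Type) (_ : Field K) (_ : CharP K p) (_ : TopologicalSpace K)
          (j : ZMod p →+* K) (ι : coeffCharIntegers f →+* K),
          IsNewform1 f ∧
            IsGaloisRepOfNewform1Int f ι {q | q ∣ N * p}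
              (FramedRep.baseChange j continuous_of_discreteTopology ρ)) :
    IsModular W :=
  isModular_of_forall_isTorsionGaloisRep_exists_isNewform1_of_three_facts hES
    isIsogenous_iff_frobeniusTrace_eq_holds hC W M p₀ h

/-- **`E` is modular along Serre's road, granted `khare_wintenberger`, the weight, the conductor
fact, Eichler–Shimura and Carayol** (Faltings discharged). [cite: Serre1987, §4.6, Théorème 4] -/
theorem isModular_of_khare_wintenberger_of_serreWeight_of_conductorNatOf_of_two_facts
    (hES : eichlerShimuraConstruction)
    (hC : ∀ (N : ℕ) [NeZero N], IsNewformOf.level_eq_conductorNorm (N := N))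
    (hN : ∀ (W : WeierstrassCurve ℚ) (ℓ : ℕ) [Fact ℓ.Prime],
      W.conductorNatOf_geomPoints_eq_conductorNorm_of_isElliptic ℓ)
    (W : WeierstrassCurve ℚ) [W.IsElliptic] [NeZero (W.conductorNorm ℤ)] (p₀ : ℕ)
    (hKW : ∀ (p : ℕ) [Fact p.Prime], p₀ ≤ p →
      ∀ (k : Type) [Field k] [TopologicalSpace k] [DiscreteTopology k], khare_wintenberger p k)
    (hwt : ∀ (p : ℕ) [Fact p.Prime], p₀ ≤ p →
      ∀ ρ : ModPGaloisRep ℚ (ZMod p) 2, W.IsTorsionGaloisRep p ρ →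
        ∀ (k : Type) [Field k] [TopologicalSpace k] [DiscreteTopology k] [CharP k p]
          [IsAlgClosed k] (j : ZMod p →+* k)
          (loc : LocalRestrictionAt p (FramedRep.baseChange j continuous_of_discreteTopology ρ))
          (ι : absIntegers 𝒪[loc.F] loc.F ⧸ absMaximalIdeal loc.F →+* k),
          serreWeight p (FramedRep.baseChange j continuous_of_discreteTopology ρ) loc ι = 2) :
    IsModular W :=
  isModular_of_khare_wintenberger_of_serreWeight_of_conductorNatOf_of_three_facts hES
    isIsogenous_iff_frobeniusTrace_eq_holds hC hN W p₀ hKW hwt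

/-- **BCDT Theorem A along Serre's road, granted `khare_wintenberger`, the weight of `ρ̄_{E,p}`
for large `p`, the conductor fact, Eichler–Shimura and Carayol** — trust base
{`khare_wintenberger p k`, `hwt` (Serre 1987 §2.8 Prop. 4),
`WeierstrassCurve.conductorNatOf_geomPoints_eq_conductorNorm_of_isElliptic`, `eichlerShimuraConstruction`,
`IsNewformOf.level_eq_conductorNorm`} (Faltings discharged).
[cite: Serre1987, §4.6, Théorème 4 with Lemme 5 (4.6.3)] -/
theorem exists_isNewformOf_of_khare_wintenberger_of_serreWeight_of_conductorNatOf_of_two_facts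
    (hKW : ∀ (p : ℕ) [Fact p.Prime] (k : Type) [Field k] [TopologicalSpace k] [DiscreteTopology k],
      khare_wintenberger p k)
    (hwt : ∀ (W : WeierstrassCurve ℚ) [W.IsElliptic], ∃ p₀ : ℕ, ∀ (p : ℕ) [Fact p.Prime], p₀ ≤ p →
      ∀ ρ : ModPGaloisRep ℚ (ZMod p) 2, W.IsTorsionGaloisRep p ρ →
        ∀ (k : Type) [Field k] [TopologicalSpace k] [DiscreteTopology k] [CharP k p]
          [IsAlgClosed k] (j : ZMod p →+* k)
          (loc : LocalRestrictionAt p (FramedRep.baseChange j continuous_of_discreteTopology ρ))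
          (ι : absIntegers 𝒪[loc.F] loc.F ⧸ absMaximalIdeal loc.F →+* k),
          serreWeight p (FramedRep.baseChange j continuous_of_discreteTopology ρ) loc ι = 2)
    (hN : ∀ (W : WeierstrassCurve ℚ) (ℓ : ℕ) [Fact ℓ.Prime],
      W.conductorNatOf_geomPoints_eq_conductorNorm_of_isElliptic ℓ)
    (hES : eichlerShimuraConstruction)
    (hC : ∀ (N : ℕ) [NeZero N], IsNewformOf.level_eq_conductorNorm (N := N)) :
    EllipticCurves.ModularForms.exists_isNewformOf :=
  exists_isNewformOf_of_khare_wintenberger_of_serreWeight_of_conductorNatOf_of_three_facts hKW hwt hN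
    hES isIsogenous_iff_frobeniusTrace_eq_holds hC

/-- **Conrad–Diamond–Taylor 1999, Theorem 7.2.2, along Serre's road, granted `khare_wintenberger`,
the weight of `ρ̄_{E,p}` for large `p`, the `ℓ`-adic description of `N_E`, Eichler–Shimura and
Carayol** — `CDT_theorem_7_2_2_of_khare_wintenberger_of_serreWeight_of_conductorNatOf_of_three_facts`
with Faltings' isogeny theorem now the tree's theorem
`WeierstrassCurve.isIsogenous_iff_frobeniusTrace_eq_holds`.
[cite: ConradDiamondTaylor1999, Thm. 7.2.2] [cite: Serre1987, §4.6, Théorème 4 and Lemme 5 (4.6.3)] -/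
theorem CDT_theorem_7_2_2_of_khare_wintenberger_of_serreWeight_of_conductorNatOf_of_two_facts
    (hKW : ∀ (p : ℕ) [Fact p.Prime] (k : Type) [Field k] [TopologicalSpace k] [DiscreteTopology k],
      khare_wintenberger p k)
    (hwt : ∀ (W : WeierstrassCurve ℚ) [W.IsElliptic], ∃ p₀ : ℕ, ∀ (p : ℕ) [Fact p.Prime], p₀ ≤ p →
      ∀ ρ : ModPGaloisRep ℚ (ZMod p) 2, W.IsTorsionGaloisRep p ρ →
        ∀ (k : Type) [Field k] [TopologicalSpace k] [DiscreteTopology k] [CharP k p]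
          [IsAlgClosed k] (j : ZMod p →+* k)
          (loc : LocalRestrictionAt p (FramedRep.baseChange j continuous_of_discreteTopology ρ))
          (ι : absIntegers 𝒪[loc.F] loc.F ⧸ absMaximalIdeal loc.F →+* k),
          serreWeight p (FramedRep.baseChange j continuous_of_discreteTopology ρ) loc ι = 2)
    (hN : ∀ (W : WeierstrassCurve ℚ) (ℓ : ℕ) [Fact ℓ.Prime],
      W.conductorNatOf_geomPoints_eq_conductorNorm_of_isElliptic ℓ)
    (hES : eichlerShimuraConstruction)
    (hC : ∀ (N : ℕ) [NeZero N], IsNewformOf.level_eq_conductorNorm (N := N)) :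
    CDT_theorem_7_2_2 :=
  CDT_theorem_7_2_2_of_khare_wintenberger_of_serreWeight_of_conductorNatOf_of_three_facts hKW hwt hN
    hES isIsogenous_iff_frobeniusTrace_eq_holds hC

end SerreRoad

end Literature.NumberTheory.Automorphic.BCDT

end
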